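import Mathlib

/-!
# T5ConjugationDecomposition — «c ∈ D_P» is «w non-split in E»

Seat p3 of the blind cell `pub-hodge-repro2` (Tier-5 support column for sub-step N2 of
`route/TIER5.md`).  A kernel witness behind row N2.2.5 of `route/T5-N2-route-3.md`: «a place of
`F⁺` above `p` is non-split in `E` iff `c ∈ D_p` …» — the first link of that chain, where `c` is
the complex conjugation, i.e. the non-trivial element of `Gal(E/F⁺)`, and `D_p` the decomposition
group (stabiliser) of a prime `P` of `𝓞 E` above `p`.

For a Galois extension `E/F` of number fields and a prime `P` of `𝓞 E` above `𝔭 = P ∩ 𝓞 F`: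

* the whole Galois group fixes `P` if and only if `P` is the only prime above `𝔭`
  (`forall_smul_eq_iff_ncard_primesOver_eq_one`: transitivity of `Gal(E/F)` on the primes above
  `𝔭`, Mathlib's `Algebra.IsInvariant.orbit_eq_primesOver`);
* if `[E : F] = 2` and `σ ≠ 1` (the conjugation), then `σ • P = P` if and only if `P` is the only
  prime above `𝔭` (`smul_eq_iff_ncard_primesOver_eq_one`: the stabiliser containing `σ` is the whole
  group of order `2`).

Declaration of README §8(d): this file uses an L-value-free non-vanishing device: NO.
-/

namespace Summit.Ventures.HodgeRepro2.T5ConjugationDecomposition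

open NumberField Ideal
open scoped Pointwise

variable {F E : Type*} [Field F] [NumberField F] [Field E] [NumberField E] [Algebra F E]
  [IsGalois F E]

/-- `Gal(E/F)` acts on `𝓞 E` as a Galois group over `𝓞 F`. -/
theorem isGaloisGroup_gal : IsGaloisGroup Gal(E/F) (𝓞 F) (𝓞 E) :=
  IsGaloisGroup.of_isFractionRing Gal(E/F) (𝓞 F) (𝓞 E) F E

/-- If every element of `Gal(E/F)` fixes `P`, then `P` is the only prime of `𝓞 E` above
`𝔭 = P ∩ 𝓞 F`. -/
theorem ncard_primesOver_eq_one_of_forall_smul_eq (P : Ideal (𝓞 E)) [P.IsPrime]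
    (h : ∀ σ : Gal(E/F), σ • P = P) : ((P.under (𝓞 F)).primesOver (𝓞 E)).ncard = 1 := by
  haveI := isGaloisGroup_gal (F := F) (E := E)
  rw [← Algebra.IsInvariant.orbit_eq_primesOver (𝓞 F) (𝓞 E) Gal(E/F) (P.under (𝓞 F)) P]
  have : MulAction.orbit Gal(E/F) P = {P} := by
    ext Q
    constructor
    · rintro ⟨σ, rfl⟩
      exact h σ
    · intro hQ
      rw [Set.mem_singleton_iff.mp hQ]
      exact MulAction.mem_orbit_self P
  rw [this, Set.ncard_singleton]

/-- If `P` is the only prime of `𝓞 E` above `𝔭 = P ∩ 𝓞 F`, then every element of `Gal(E/F)`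
fixes `P`. -/
theorem smul_eq_of_ncard_primesOver_eq_one (P : Ideal (𝓞 E)) [P.IsPrime]
    (h : ((P.under (𝓞 F)).primesOver (𝓞 E)).ncard = 1) (σ : Gal(E/F)) : σ • P = P := by
  haveI := isGaloisGroup_gal (F := F) (E := E)
  obtain ⟨Q, hQ⟩ := Set.ncard_eq_one.mp h
  have h1 : P ∈ (P.under (𝓞 F)).primesOver (𝓞 E) := ⟨inferInstance, inferInstance⟩
  have h2 : σ • P ∈ (P.under (𝓞 F)).primesOver (𝓞 E) :=
    (primesOver.mk (P.under (𝓞 F)) (σ • P)).2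
  rw [hQ, Set.mem_singleton_iff] at h1 h2
  rw [h2, h1]

/-- **Decomposition group = everything ⟺ non-split.**  The whole Galois group `Gal(E/F)` fixes `P`
if and only if `P` is the only prime of `𝓞 E` above `𝔭 = P ∩ 𝓞 F`. -/
theorem forall_smul_eq_iff_ncard_primesOver_eq_one (P : Ideal (𝓞 E)) [P.IsPrime] :
    (∀ σ : Gal(E/F), σ • P = P) ↔ ((P.under (𝓞 F)).primesOver (𝓞 E)).ncard = 1 :=
  ⟨ncard_primesOver_eq_one_of_forall_smul_eq P, smul_eq_of_ncard_primesOver_eq_one P⟩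

/-- In a quadratic Galois extension, a non-trivial automorphism `σ` (the conjugation) generates:
every `τ` is `1` or `σ`. -/
theorem eq_one_or_eq_of_finrank_eq_two (hFE : Module.finrank F E = 2) {σ : Gal(E/F)}
    (hσ : σ ≠ 1) (τ : Gal(E/F)) : τ = 1 ∨ τ = σ := by
  have hcard : Nat.card Gal(E/F) = 2 := by rw [IsGalois.card_aut_eq_finrank, hFE]
  have htop : Subgroup.zpowers σ = ⊤ := by
    apply Subgroup.eq_top_of_card_eq
    have h1 : 1 < Nat.card (Subgroup.zpowers σ) :=
      (Subgroup.one_lt_card_iff_ne_bot _).mpr (by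
        intro h
        exact hσ (Subgroup.mem_bot.mp (h ▸ Subgroup.mem_zpowers σ)))
    have h2 : Nat.card (Subgroup.zpowers σ) ≤ Nat.card Gal(E/F) := Subgroup.card_le_card_group _
    omega
  have hτ : τ ∈ Subgroup.zpowers σ := htop ▸ Subgroup.mem_top τ
  obtain ⟨k, rfl⟩ := Subgroup.mem_zpowers_iff.mp hτ
  have hσ2 : σ ^ 2 = 1 := by rw [← hcard]; exact pow_card_eq_one'
  have hσz : ∀ n : ℤ, σ ^ n = 1 ∨ σ ^ n = σ := by
    intro n
    obtain ⟨q, r, hr, hn⟩ : ∃ q r : ℤ, (r = 0 ∨ r = 1) ∧ n = 2 * q + r :=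
      ⟨n / 2, n % 2, by omega, by omega⟩
    rw [hn, zpow_add, zpow_mul, show (2 : ℤ) = ((2 : ℕ) : ℤ) from rfl, zpow_natCast, hσ2,
      one_zpow, one_mul]
    rcases hr with rfl | rfl
    · left; exact zpow_zero σ
    · right; exact zpow_one σ
  exact hσz k

/-- **«c ∈ D_P ⟺ w non-split in E».**  For a quadratic Galois extension `E/F` of number fields
with conjugation `σ ≠ 1`, and a prime `P` of `𝓞 E`: `σ` fixes `P` (i.e. `σ` lies in the
decomposition group of `P`) if and only if `P` is the only prime of `𝓞 E` above `w = P ∩ 𝓞 F`. -/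
theorem smul_eq_iff_ncard_primesOver_eq_one (hFE : Module.finrank F E = 2) {σ : Gal(E/F)}
    (hσ : σ ≠ 1) (P : Ideal (𝓞 E)) [P.IsPrime] :
    σ • P = P ↔ ((P.under (𝓞 F)).primesOver (𝓞 E)).ncard = 1 := by
  rw [← forall_smul_eq_iff_ncard_primesOver_eq_one]
  constructor
  · intro h τ
    rcases eq_one_or_eq_of_finrank_eq_two hFE hσ τ with rfl | rfl
    · exact one_smul _ P
    · exact h
  · intro h
    exact h σ

end Summit.Ventures.HodgeRepro2.T5ConjugationDecomposition
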